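import Summits.QuantumFields.BalabanUV.Beta.CompositeVertexKernelBounds

/-!
# `BalabanUV.Beta.CompositeHessianTable` — row D1 ∕ (C1), file F6a (brick-generic): THE m-FOLD COMPOSITE AVERAGING's
# FIELD–FIELD CONSTRAINT HESSIAN TABLE — the `H` member of the composite table record `tabsComp m : SymTables d (L^m)`

WHAT.  The field–field Hessian of a composite of block averagings obeys the SAME top-peeled second-order chain rule as the
mixed (field–background) vertex of `CompositeVertexKernelRec` — both slots are bonds transported by the composite LINEAR kernel
`compLinKer`, the top step contributes its own second-order brick along the two transported bonds plus its linear kernel composed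
with the lower composite's Hessian.  Hence the composite Hessian KERNEL is `compVHKer ℓ 𝒽 L m` READ AT THE HESSIAN BRICK `𝒽`
(an1's `hessKerAt (toSite (r m)) L` ∕ `symHessKerAt (toSite r) L` in the two presentations), and this file only has to PACK it on the
field–field block and discharge the `SymTables` letters (LH)(TH):
* §1 `packFF K μ y` — the field–field packer (`((x, inl α), (x′, inl α′)) ↦ K μ y (α, x) (α′, x′)`, zero elsewhere; the shape of
  an1's `hessFFAt` ∕ `symHessFFAt`, which it recovers at `K := hessKerAt ρ L` ∕ `symHessKerAt ρ L` by `rfl`); antisymmetry, a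
  WINDOW-GENERIC vertex-family letter `vertexFamily_packFF_of_window` (twin of F3b's `locStencil_packVH_of_window`), translation.
* §2 `compHessFF ℓ 𝒽 L m := packFF (compVHKer ℓ 𝒽 L m)`; `compVHKer_swap` (an ANTISYMMETRIC second-order brick gives an
  antisymmetric composite kernel — induction) ⇒ `compHessFF_antisymm`; **(LH) `vertexFamily_compHessFF`** at blocking `L^m`, EVERY
  rate `δ ≥ 0`, constant `bndVH m · e^{2(d+1)·wid m·δ}`, letter shape `compHessFF_hH`; **(TH) `compHessFF_translate`**, letter shape
  `compHessFF_hHt`.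
* §3 THE TWO INSTANTIATIONS BY NAME: (R) rooted bricks `linKerAt ∕ hessKerAt (toSite (r m)) L` — anchor **`compHessFF_rooted_one`**
  (`= hessFFAt (toSite (r 0)) L`), (LH)(TH) + antisymmetry; (S) symmetrised bricks `symLinKerAt ∕ symHessKerAt (toSite r) L` — anchor
  **`compHessFF_sym_one`** (`= symHessFFAt (toSite r) L`), (LH)(TH) + antisymmetry.  The multiplier tables `M j := M1Of d (L^m) H (cΛ m) j`
  then inherit (LM)(TM) by `MultiplierTableSlot.vertexFamily_M1Of ∕ M1Of_translate` (not imported here).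

WHY (located).  g50 FINAL (3) ∕ SPEC S-an2-g49-1 v1.1 §1: F6 `tabsComp : ∀ m, SymTables 3 (Lc^m)` needs the five composite tables with
their ten letters; `V` ∕ `vh₂S` are F3∕F5 (`compVhS ∕ compVh2S`); this is `H` (and through `M1Of`, `M`).  Presentation-FREE like
F3∕F5: RULING R-D1-g50-2 keeps (TAB) open and orders no re-basing — both instantiations are typed, one line each.  [folklore] finite
sums ∕ inductions over OUR typed objects + an1's brick letters BY NAME; two [our object] bookkeeping definitions (`packFF`,
`compHessFF`).  Nothing of Bałaban's asserted, valued or discharged; 0 estimates; 0∕4 row-D1 binders; NOT (C1), NOT D1, NEVER «G-an2-4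
closed», NOT BetaPertH, NOT continuum, NOT Clay.

HONEST DEPENDENCY (page 1, mandatory): continuum YM on T⁴ ⇐ BetaPertH ∧ nine spine estimates (0/9 proved); BetaPertH ⇐ (D1) ∧
(D4) ∧ CAP+tail; G-an2-4 gates asym, D1 and NE2/3/4.  Row D1 ∕ (C1) OWNER an2, gen 51, 2026-08-23.  No existing file touched.
-/

noncomputable section

open scoped BigOperators

namespace Summit.QuantumFields.BalabanUV.Beta.CompositeHessianTable

open Finset
open Literature.MathematicalPhysics.QuantumFieldTheory.Balaban1983to89
open Literature.MathematicalPhysics.QuantumFieldTheory.Balaban1983to89.Beta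
open AffineAveraging (Site box toSite)
open AveragingHessianKernels (Bond Near ell)
open AveragingHessianKernelsRooted (linKerAt hessKerAt hessFFAt)
open SymAveragingHessianCounts (symLinKerAt symHessKerAt symHessFFAt)
open ExpKernelCalculus (MKer BiLoc VertexFamily shiftK)
open OneStepResolventKernel (Fib)
open B12Sec2to5 (l1 l1_nonneg)
open Summit.QuantumFields.BalabanUV.Beta.CompositeVertexKernelRec (offs winF wid compLinKer compVHKer compVHKer_zero compVHKer_succ
  compVHKer_eq_zero_left compVHKer_eq_zero_right compVHKer_sh compVHKer_one bndVH bndVH_nonneg abs_compVHKer_le smul_mem_winF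
  l1_le_of_mem_winF)

variable {d : ℕ}

/-! ## §1 The field–field packer -/

/-- [our object — bookkeeping] **THE FIELD–FIELD PACKER**: a per-coarse-bond kernel family `K μ y f f′` over pairs of fine bonds becomes
the `MKer (d+1) (Fib d)` with entry `((x, inl α), (x′, inl α′)) ↦ K μ y (α, x) (α′, x′)` and `0` on every block touching a multiplier
index (the shape of an1's `hessFFAt ρ L μ y` ∕ `symHessFFAt ρ L μ y`). -/
def packFF (K : Fin (d + 1) → Site (d + 1) → Bond (d + 1) → Bond (d + 1) → ℝ) (μ : Fin (d + 1)) (y : Site (d + 1)) :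
    MKer (d + 1) (Fib d) := fun x x' a b =>
  match a, b with
  | Sum.inl α, Sum.inl α' => K μ y (α, x) (α', x')
  | _, _ => 0

variable (K : Fin (d + 1) → Site (d + 1) → Bond (d + 1) → Bond (d + 1) → ℝ)

/-- [folklore] The field–field entries of the packer. -/
@[simp] theorem packFF_inl_inl (μ : Fin (d + 1)) (y x x' : Site (d + 1)) (α α' : Fin (d + 1)) :
    packFF K μ y x x' (Sum.inl α) (Sum.inl α') = K μ y (α, x) (α', x') := rfl

/-- [folklore] The packer vanishes on `(inl, inr)`. -/
@[simp] theorem packFF_inl_inr (μ : Fin (d + 1)) (y x x' : Site (d + 1)) (α μ' : Fin (d + 1)) :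
    packFF K μ y x x' (Sum.inl α) (Sum.inr μ') = 0 := rfl

/-- [folklore] The packer vanishes on `(inr, ·)`. -/
@[simp] theorem packFF_inr (μ : Fin (d + 1)) (y x x' : Site (d + 1)) (μ' : Fin (d + 1)) (b : Fib d) :
    packFF K μ y x x' (Sum.inr μ') b = 0 := by cases b <;> rfl

/-- [folklore] BRIDGE (by cases, `rfl`): an1's ROOTED constraint Hessian table IS the packing of its Hessian kernel. -/
theorem packFF_hessKerAt (ρ : Site (d + 1)) (L : ℕ) : packFF (hessKerAt ρ L) = hessFFAt ρ L := by
  funext μ y x x' a b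
  rcases a with α | ν <;> rcases b with α' | ν' <;> rfl

/-- [folklore] BRIDGE (by cases, `rfl`): an1's SYMMETRISED constraint Hessian table IS the packing of its symmetrised Hessian kernel. -/
theorem packFF_symHessKerAt (ρ : Site (d + 1)) (L : ℕ) : packFF (symHessKerAt ρ L) = symHessFFAt ρ L := by
  funext μ y x x' a b
  rcases a with α | ν <;> rcases b with α' | ν' <;> rfl

/-- [folklore] An ANTISYMMETRIC kernel packs to an antisymmetric table (the coefficient of a commutator). -/
theorem packFF_antisymm (hK : ∀ μ y f f', K μ y f' f = -K μ y f f') (μ : Fin (d + 1)) (y x x' : Site (d + 1)) (a b : Fib d) :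
    packFF K μ y x' x b a = -packFF K μ y x x' a b := by
  rcases a with α | ν <;> rcases b with α' | ν'
  · rw [packFF_inl_inl, packFF_inl_inl]; exact hK μ y (α, x) (α', x')
  all_goals simp

/-- [folklore] **A PACKED KERNEL FAMILY SUPPORTED IN SCALE-`N` WINDOWS OF WIDTH `W` IS A FIRST-ORDER VERTEX FAMILY AT BLOCKING `N`** at
every rate `δ ≥ 0`, constant `C · e^{2(d+1)Wδ}` (bi-localised at the coarse bond position `N·y`, which opens the window; twin of F3b's
`locStencil_packVH_of_window`). -/
theorem vertexFamily_packFF_of_window {N : ℕ} (W : ℕ) {C : ℝ} (hC : 0 ≤ C)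
    (h₁ : ∀ μ y f f', f.2 ∉ winF N W y → K μ y f f' = 0) (h₂ : ∀ μ y f f', f'.2 ∉ winF N W y → K μ y f f' = 0)
    (hb : ∀ μ y f f', |K μ y f f'| ≤ C) {δ : ℝ} (hδ : 0 ≤ δ) :
    VertexFamily (packFF K) N (C * Real.exp (2 * ((d : ℝ) + 1) * W * δ)) δ := by
  intro μ y x x' a b
  have hpos : 0 ≤ C * Real.exp (2 * ((d : ℝ) + 1) * W * δ) * Real.exp (-δ * (l1 (x - (N : ℤ) • y) + l1 (x' - (N : ℤ) • y))) :=
    mul_nonneg (mul_nonneg hC (Real.exp_pos _).le) (Real.exp_pos _).le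
  rcases a with α | ν
  · rcases b with α' | ν'
    · rw [packFF_inl_inl]
      by_cases hx : x ∈ winF N W y
      · by_cases hx' : x' ∈ winF N W y
        · have h0 := smul_mem_winF (N := N) (W := W) y
          have d1 := l1_le_of_mem_winF hx h0
          have d2 := l1_le_of_mem_winF hx' h0
          have hW' : (0 : ℝ) ≤ (W : ℝ) := Nat.cast_nonneg W
          have hsum : δ * (l1 (x - (N : ℤ) • y) + l1 (x' - (N : ℤ) • y)) ≤ 2 * ((d : ℝ) + 1) * W * δ := by nlinarith
          have h1 : 1 ≤ Real.exp (2 * ((d : ℝ) + 1) * W * δ) * Real.exp (-δ * (l1 (x - (N : ℤ) • y) + l1 (x' - (N : ℤ) • y))) := by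
            rw [← Real.exp_add]; exact Real.one_le_exp (by linarith)
          calc |K μ y (α, x) (α', x')| ≤ C * 1 := by rw [mul_one]; exact hb _ _ _ _
            _ ≤ C * (Real.exp (2 * ((d : ℝ) + 1) * W * δ) * Real.exp (-δ * (l1 (x - (N : ℤ) • y) + l1 (x' - (N : ℤ) • y)))) :=
                mul_le_mul_of_nonneg_left h1 hC
            _ = _ := by ring
        · rw [h₂ μ y (α, x) (α', x') hx', abs_zero]; exact hpos
      · rw [h₁ μ y (α, x) (α', x') hx, abs_zero]; exact hpos
    · rw [packFF_inl_inr, abs_zero]; exact hpos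
  · rw [packFF_inr, abs_zero]; exact hpos

/-- [folklore] **TRANSLATION COVARIANCE OF THE PACKED TABLE** from block covariance of the kernel (coarse bond by `t`, fine bonds by `N·t`):
`packFF K μ (y + t) = shiftK (−N·t) (packFF K μ y)` (node 7a's byte shape `hessFFAt_translate`). -/
theorem packFF_translate {N : ℕ} (hK : ∀ μ y t f f', K μ (y + t) (f.sh ((N : ℤ) • t)) (f'.sh ((N : ℤ) • t)) = K μ y f f')
    (μ : Fin (d + 1)) (y t : Site (d + 1)) :
    packFF K μ (y + t) = shiftK (-((N : ℤ) • t)) (packFF K μ y) := by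
  funext x x' a b
  simp only [shiftK]
  rcases a with α | ν
  · rcases b with α' | ν'
    · rw [packFF_inl_inl, packFF_inl_inl]
      have := hK μ y t (α, x + -((N : ℤ) • t)) (α', x' + -((N : ℤ) • t))
      rw [← this]
      congr 1 <;> simp [Bond.sh]
    · rfl
  · cases b <;> rfl

/-! ## §2 The composite field–field Hessian table -/

/-- [folklore] Exchanging the two window bond pairs of a quadruple window sum (bookkeeping for the antisymmetry induction). -/
theorem sum_window_pair_comm {L : ℕ} (F : Fin (d + 1) → Site (d + 1) → Fin (d + 1) → Site (d + 1) → ℝ) :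
    (∑ κ : Fin (d + 1), ∑ e ∈ offs L, ∑ κ' : Fin (d + 1), ∑ e' ∈ offs L, F κ e κ' e')
      = ∑ κ' : Fin (d + 1), ∑ e' ∈ offs L, ∑ κ : Fin (d + 1), ∑ e ∈ offs L, F κ e κ' e' := by
  calc (∑ κ : Fin (d + 1), ∑ e ∈ offs L, ∑ κ' : Fin (d + 1), ∑ e' ∈ offs L, F κ e κ' e')
      = ∑ κ : Fin (d + 1), ∑ κ' : Fin (d + 1), ∑ e ∈ offs L, ∑ e' ∈ offs L, F κ e κ' e' :=
        Finset.sum_congr rfl fun _ _ => Finset.sum_comm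
    _ = ∑ κ : Fin (d + 1), ∑ κ' : Fin (d + 1), ∑ e' ∈ offs L, ∑ e ∈ offs L, F κ e κ' e' :=
        Finset.sum_congr rfl fun _ _ => Finset.sum_congr rfl fun _ _ => Finset.sum_comm
    _ = ∑ κ' : Fin (d + 1), ∑ κ : Fin (d + 1), ∑ e' ∈ offs L, ∑ e ∈ offs L, F κ e κ' e' := Finset.sum_comm
    _ = ∑ κ' : Fin (d + 1), ∑ e' ∈ offs L, ∑ κ : Fin (d + 1), ∑ e ∈ offs L, F κ e κ' e' :=
        Finset.sum_congr rfl fun _ _ => Finset.sum_comm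

variable (ℓ : ℕ → Fin (d + 1) → Site (d + 1) → Bond (d + 1) → ℝ)
  (𝒽 : ℕ → Fin (d + 1) → Site (d + 1) → Bond (d + 1) → Bond (d + 1) → ℝ) (L : ℕ)

/-- [our object — bookkeeping] **THE COMPOSITE FIELD–FIELD CONSTRAINT HESSIAN TABLE AT DEPTH `m`** (blocking `L^m`): the top-peeled
composite second-order kernel of `CompositeVertexKernelRec` read at a HESSIAN brick `𝒽` (both bond slots are fluctuation bonds,
transported by `compLinKer`), packed on the field–field block. -/
def compHessFF (m : ℕ) : Fin (d + 1) → Site (d + 1) → MKer (d + 1) (Fib d) := packFF (compVHKer ℓ 𝒽 L m)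

variable {ℓ 𝒽 L}

/-- [folklore] unfolding. -/
theorem compHessFF_apply (m : ℕ) (μ : Fin (d + 1)) (y : Site (d + 1)) : compHessFF ℓ 𝒽 L m μ y = packFF (compVHKer ℓ 𝒽 L m) μ y := rfl

/-- [folklore] The field–field entries of the composite Hessian table are the composite kernel. -/
@[simp] theorem compHessFF_inl_inl (m : ℕ) (μ : Fin (d + 1)) (y x x' : Site (d + 1)) (α α' : Fin (d + 1)) :
    compHessFF ℓ 𝒽 L m μ y x x' (Sum.inl α) (Sum.inl α') = compVHKer ℓ 𝒽 L m μ y (α, x) (α', x') := rfl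

/-- [folklore] The depth-`0` composite (the identity averaging) has no Hessian. -/
theorem compHessFF_zero (μ : Fin (d + 1)) (y : Site (d + 1)) : compHessFF ℓ 𝒽 L 0 μ y = 0 := by
  funext x x' a b
  rcases a with α | ν <;> rcases b with α' | ν' <;> rfl

/-- [folklore] **AN ANTISYMMETRIC SECOND-ORDER BRICK GIVES AN ANTISYMMETRIC COMPOSITE KERNEL** (induction on the depth: in the top
summand exchange the two window bond pairs, in the lower summand the induction hypothesis). -/
theorem compVHKer_swap (h𝒽 : ∀ m μ y f f', 𝒽 m μ y f' f = -𝒽 m μ y f f') :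
    ∀ (m : ℕ) (μ : Fin (d + 1)) (y : Site (d + 1)) (f f' : Bond (d + 1)),
      compVHKer ℓ 𝒽 L m μ y f' f = -compVHKer ℓ 𝒽 L m μ y f f'
  | 0, _, _, _, _ => by rw [compVHKer_zero, compVHKer_zero, neg_zero]
  | m + 1, μ, y, f, f' => by
      rw [compVHKer_succ, compVHKer_succ, neg_add, ← Finset.sum_neg_distrib, ← Finset.sum_neg_distrib]
      congr 1
      · rw [sum_window_pair_comm (L := L) (fun κ e κ' e' => 𝒽 m μ y (κ, (L : ℤ) • y + e) (κ', (L : ℤ) • y + e')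
          * compLinKer ℓ L m f' (κ, (L : ℤ) • y + e) * compLinKer ℓ L m f (κ', (L : ℤ) • y + e'))]
        refine Finset.sum_congr rfl fun κ _ => ?_
        rw [← Finset.sum_neg_distrib]
        refine Finset.sum_congr rfl fun e _ => ?_
        rw [← Finset.sum_neg_distrib]
        refine Finset.sum_congr rfl fun κ' _ => ?_
        rw [← Finset.sum_neg_distrib]
        refine Finset.sum_congr rfl fun e' _ => ?_
        rw [h𝒽 m μ y (κ, (L : ℤ) • y + e) (κ', (L : ℤ) • y + e')]
        ring
      · refine Finset.sum_congr rfl fun κ _ => ?_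
        rw [← Finset.sum_neg_distrib]
        refine Finset.sum_congr rfl fun e _ => ?_
        rw [compVHKer_swap h𝒽 m, mul_neg]

/-- [folklore] **THE COMPOSITE HESSIAN TABLE IS ANTISYMMETRIC** for an antisymmetric Hessian brick. -/
theorem compHessFF_antisymm (h𝒽 : ∀ m μ y f f', 𝒽 m μ y f' f = -𝒽 m μ y f f') (m : ℕ) (μ : Fin (d + 1)) (y x x' : Site (d + 1))
    (a b : Fib d) : compHessFF ℓ 𝒽 L m μ y x' x b a = -compHessFF ℓ 𝒽 L m μ y x x' a b :=
  packFF_antisymm _ (fun μ y f f' => compVHKer_swap h𝒽 m μ y f f') μ y x x' a b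

/-- [folklore] **(LH)-SHAPE LOCALITY OF THE COMPOSITE HESSIAN TABLE AT EVERY RATE**: `VertexFamily (compHessFF … m) (L^m)
(bndVH m · e^{2(d+1)·wid m·δ}) δ` (the windows of F3 `compVHKer_eq_zero_left ∕ _right`, the bound of F3b `abs_compVHKer_le`). -/
theorem vertexFamily_compHessFF {Bℓ B𝒽 : ℝ} (hB : 0 ≤ Bℓ) (hB' : 0 ≤ B𝒽)
    (hℓb : ∀ m μ y f, |ℓ m μ y f| ≤ Bℓ) (h𝒽b : ∀ m μ y f f', |𝒽 m μ y f f'| ≤ B𝒽) (m : ℕ) {δ : ℝ} (hδ : 0 ≤ δ) :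
    VertexFamily (compHessFF ℓ 𝒽 L m) (L ^ m) (bndVH d L Bℓ B𝒽 m * Real.exp (2 * ((d : ℝ) + 1) * (wid L m) * δ)) δ :=
  vertexFamily_packFF_of_window _ (wid L m) (bndVH_nonneg hB hB' m)
    (fun _ _ _ f' h => compVHKer_eq_zero_left m f' h) (fun _ _ f _ h => compVHKer_eq_zero_right m f h)
    (abs_compVHKer_le hB hB' hℓb h𝒽b m) hδ

/-- [folklore] **(LH) in the record's letter shape**: `∀ δ ≥ 0, ∃ C, VertexFamily (compHessFF … m) (L^m) C δ`. -/
theorem compHessFF_hH {Bℓ B𝒽 : ℝ} (hB : 0 ≤ Bℓ) (hB' : 0 ≤ B𝒽)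
    (hℓb : ∀ m μ y f, |ℓ m μ y f| ≤ Bℓ) (h𝒽b : ∀ m μ y f f', |𝒽 m μ y f f'| ≤ B𝒽) (m : ℕ) :
    ∀ δ : ℝ, 0 ≤ δ → ∃ C : ℝ, VertexFamily (compHessFF ℓ 𝒽 L m) (L ^ m) C δ :=
  fun _ hδ => ⟨_, vertexFamily_compHessFF hB hB' hℓb h𝒽b m hδ⟩

/-- [folklore] **(TH)-SHAPE COVARIANCE OF THE COMPOSITE HESSIAN TABLE** under coarse translations (fine side by `L^m·t`), from the
block covariance of the bricks (F3 `compVHKer_sh`). -/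
theorem compHessFF_translate (hℓsh : ∀ m μ y t f, ℓ m μ (y + t) (f.sh ((L : ℤ) • t)) = ℓ m μ y f)
    (h𝒽sh : ∀ m μ y t f f', 𝒽 m μ (y + t) (f.sh ((L : ℤ) • t)) (f'.sh ((L : ℤ) • t)) = 𝒽 m μ y f f')
    (m : ℕ) (μ : Fin (d + 1)) (y t : Site (d + 1)) :
    compHessFF ℓ 𝒽 L m μ (y + t) = shiftK (-(((L ^ m : ℕ) : ℤ) • t)) (compHessFF ℓ 𝒽 L m μ y) :=
  packFF_translate _ (fun μ y t f f' => by rw [Nat.cast_pow]; exact compVHKer_sh hℓsh h𝒽sh m μ y t f f') μ y t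

/-- [folklore] **(TH) in the record's letter shape**. -/
theorem compHessFF_hHt (hℓsh : ∀ m μ y t f, ℓ m μ (y + t) (f.sh ((L : ℤ) • t)) = ℓ m μ y f)
    (h𝒽sh : ∀ m μ y t f f', 𝒽 m μ (y + t) (f.sh ((L : ℤ) • t)) (f'.sh ((L : ℤ) • t)) = 𝒽 m μ y f f') (m : ℕ) :
    ∀ (μ : Fin (d + 1)) (y t : Site (d + 1)),
      compHessFF ℓ 𝒽 L m μ (y + t) = shiftK (-(((L ^ m : ℕ) : ℤ) • t)) (compHessFF ℓ 𝒽 L m μ y) :=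
  fun μ y t => compHessFF_translate hℓsh h𝒽sh m μ y t

/-! ## §3 The two instantiations by name -/

section Rooted

variable {L : ℕ} {r : ℕ → (Fin (d + 1) → ℕ)}

/-- [folklore] (R) ANCHOR: over an1's ROOTED single-comb-order bricks the depth-one composite Hessian table IS `hessFFAt (toSite (r 0)) L`. -/
theorem compHessFF_rooted_one (hr : ∀ k, r k ∈ box (d + 1) L) :
    compHessFF (fun m => linKerAt (toSite (r m)) L) (fun m => hessKerAt (toSite (r m)) L) L 1 = hessFFAt (toSite (r 0)) L := by
  have e : compVHKer (fun m => linKerAt (toSite (r m)) L) (fun m => hessKerAt (toSite (r m)) L) L 1 = hessKerAt (toSite (r 0)) L := by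
    funext μ y f f'
    exact compVHKer_one (fun m _ _ _ f' h => AveragingHessianKernelsRooted.hessKerAt_eq_zero_left (hr m) h f')
      (fun m _ _ f _ h => AveragingHessianKernelsRooted.hessKerAt_eq_zero_right (hr m) f h) μ y f f'
  unfold compHessFF
  rw [e, packFF_hessKerAt]

/-- [folklore] (R) the rooted composite Hessian table is antisymmetric (an1's `hessKerAt_swap`). -/
theorem compHessFF_rooted_antisymm (m : ℕ) (μ : Fin (d + 1)) (y x x' : Site (d + 1)) (a b : Fib d) :
    compHessFF (fun m => linKerAt (toSite (r m)) L) (fun m => hessKerAt (toSite (r m)) L) L m μ y x' x b a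
      = -compHessFF (fun m => linKerAt (toSite (r m)) L) (fun m => hessKerAt (toSite (r m)) L) L m μ y x x' a b :=
  compHessFF_antisymm (ℓ := fun m => linKerAt (toSite (r m)) L) (𝒽 := fun m => hessKerAt (toSite (r m)) L)
    (fun m μ y f f' => AveragingHessianKernelsRooted.hessKerAt_swap (toSite (r m)) L μ y f f') m μ y x x' a b

/-- [folklore] (R) (LH): the rooted composite Hessian table at blocking `L^m` is a first-order vertex family at every rate. -/
theorem vertexFamily_compHessFF_rooted (hL : 1 ≤ L) (hr : ∀ k, r k ∈ box (d + 1) L) (m : ℕ) {δ : ℝ} (hδ : 0 ≤ δ) :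
    VertexFamily (compHessFF (fun m => linKerAt (toSite (r m)) L) (fun m => hessKerAt (toSite (r m)) L) L m) (L ^ m)
      (bndVH d L (ell (d + 1) L : ℝ) (2 * (ell (d + 1) L : ℝ) ^ 2) m * Real.exp (2 * ((d : ℝ) + 1) * (wid L m) * δ)) δ :=
  vertexFamily_compHessFF (ℓ := fun m => linKerAt (toSite (r m)) L) (𝒽 := fun m => hessKerAt (toSite (r m)) L)
    (by positivity) (by positivity)
    (fun m μ y f => AveragingHessianKernelsRooted.abs_linKerAt_le hL μ y (hr m) f)
    (fun m μ y f f' => AveragingHessianKernelsRooted.abs_hessKerAt_le hL μ y (hr m) f f') m hδ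

/-- [folklore] (R) (LH) in the record's letter shape. -/
theorem compHessFF_rooted_hH (hL : 1 ≤ L) (hr : ∀ k, r k ∈ box (d + 1) L) (m : ℕ) :
    ∀ δ : ℝ, 0 ≤ δ → ∃ C : ℝ,
      VertexFamily (compHessFF (fun m => linKerAt (toSite (r m)) L) (fun m => hessKerAt (toSite (r m)) L) L m) (L ^ m) C δ :=
  fun _ hδ => ⟨_, vertexFamily_compHessFF_rooted hL hr m hδ⟩

/-- [folklore] (R) (TH): translation covariance of the rooted composite Hessian table at blocking `L^m`. -/
theorem compHessFF_rooted_translate (m : ℕ) (μ : Fin (d + 1)) (y t : Site (d + 1)) :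
    compHessFF (fun m => linKerAt (toSite (r m)) L) (fun m => hessKerAt (toSite (r m)) L) L m μ (y + t)
      = shiftK (-(((L ^ m : ℕ) : ℤ) • t))
          (compHessFF (fun m => linKerAt (toSite (r m)) L) (fun m => hessKerAt (toSite (r m)) L) L m μ y) :=
  compHessFF_translate (ℓ := fun m => linKerAt (toSite (r m)) L) (𝒽 := fun m => hessKerAt (toSite (r m)) L)
    (fun m μ y t f => AveragingHessianKernelsRooted.linKerAt_add (toSite (r m)) L μ y t f)
    (fun m μ y t f f' => AveragingHessianKernelsRooted.hessKerAt_add (toSite (r m)) L μ y t f f') m μ y t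

end Rooted

section Sym

variable {L : ℕ} {r : Fin (d + 1) → ℕ}

/-- [folklore] (S) ANCHOR: over an1's (0.4)-SYMMETRISED bricks the depth-one composite Hessian table IS `symHessFFAt (toSite r) L`. -/
theorem compHessFF_sym_one (hr : r ∈ box (d + 1) L) :
    compHessFF (fun _ => symLinKerAt (toSite r) L) (fun _ => symHessKerAt (toSite r) L) L 1 = symHessFFAt (toSite r) L := by
  have e : compVHKer (fun _ => symLinKerAt (toSite r) L) (fun _ => symHessKerAt (toSite r) L) L 1 = symHessKerAt (toSite r) L := by
    funext μ y f f'
    exact compVHKer_one (fun _ _ _ _ f' h => SymAveragingHessianCounts.symHessKerAt_eq_zero_left hr h f')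
      (fun _ _ _ f _ h => SymAveragingHessianCounts.symHessKerAt_eq_zero_right hr f h) μ y f f'
  unfold compHessFF
  rw [e, packFF_symHessKerAt]

/-- [folklore] (S) the symmetrised composite Hessian table is antisymmetric (an1's `symHessKerAt_swap`). -/
theorem compHessFF_sym_antisymm (m : ℕ) (μ : Fin (d + 1)) (y x x' : Site (d + 1)) (a b : Fib d) :
    compHessFF (fun _ => symLinKerAt (toSite r) L) (fun _ => symHessKerAt (toSite r) L) L m μ y x' x b a
      = -compHessFF (fun _ => symLinKerAt (toSite r) L) (fun _ => symHessKerAt (toSite r) L) L m μ y x x' a b :=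
  compHessFF_antisymm (ℓ := fun _ => symLinKerAt (toSite r) L) (𝒽 := fun _ => symHessKerAt (toSite r) L)
    (fun _ μ y f f' => SymAveragingHessianCounts.symHessKerAt_swap (toSite r) L μ y f f') m μ y x x' a b

/-- [folklore] (S) (LH): the symmetrised composite Hessian table at blocking `L^m` is a first-order vertex family at every rate. -/
theorem vertexFamily_compHessFF_sym (hL : 1 ≤ L) (hr : r ∈ box (d + 1) L) (m : ℕ) {δ : ℝ} (hδ : 0 ≤ δ) :
    VertexFamily (compHessFF (fun _ => symLinKerAt (toSite r) L) (fun _ => symHessKerAt (toSite r) L) L m) (L ^ m)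
      (bndVH d L (ell (d + 1) L : ℝ) (2 * (ell (d + 1) L : ℝ) ^ 2) m * Real.exp (2 * ((d : ℝ) + 1) * (wid L m) * δ)) δ :=
  vertexFamily_compHessFF (ℓ := fun _ => symLinKerAt (toSite r) L) (𝒽 := fun _ => symHessKerAt (toSite r) L)
    (by positivity) (by positivity)
    (fun _ μ y f => SymAveragingHessianCounts.abs_symLinKerAt_le hL μ y hr f)
    (fun _ μ y f f' => SymAveragingHessianCounts.abs_symHessKerAt_le hL μ y hr f f') m hδ

/-- [folklore] (S) (LH) in the record's letter shape. -/
theorem compHessFF_sym_hH (hL : 1 ≤ L) (hr : r ∈ box (d + 1) L) (m : ℕ) :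
    ∀ δ : ℝ, 0 ≤ δ → ∃ C : ℝ,
      VertexFamily (compHessFF (fun _ => symLinKerAt (toSite r) L) (fun _ => symHessKerAt (toSite r) L) L m) (L ^ m) C δ :=
  fun _ hδ => ⟨_, vertexFamily_compHessFF_sym hL hr m hδ⟩

/-- [folklore] (S) (TH): translation covariance of the symmetrised composite Hessian table at blocking `L^m`. -/
theorem compHessFF_sym_translate (m : ℕ) (μ : Fin (d + 1)) (y t : Site (d + 1)) :
    compHessFF (fun _ => symLinKerAt (toSite r) L) (fun _ => symHessKerAt (toSite r) L) L m μ (y + t)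
      = shiftK (-(((L ^ m : ℕ) : ℤ) • t))
          (compHessFF (fun _ => symLinKerAt (toSite r) L) (fun _ => symHessKerAt (toSite r) L) L m μ y) :=
  compHessFF_translate (ℓ := fun _ => symLinKerAt (toSite r) L) (𝒽 := fun _ => symHessKerAt (toSite r) L)
    (fun _ μ y t f => SymAveragingHessianCounts.symLinKerAt_add (toSite r) L μ y t f)
    (fun _ μ y t f f' => SymAveragingHessianCounts.symHessKerAt_add (toSite r) L μ y t f f') m μ y t

end Sym

end Summit.QuantumFields.BalabanUV.Beta.CompositeHessianTable

end
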